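import Literature.MathematicalPhysics.QuantumFieldTheory.Balaban1983to89.Node00.Record13InhabitedOfThm1C

/-!
# NODE 00 (YM-PLAN Track A) — STAGE 13: THE COMPARABILITY OF THE THRESHOLDS `ε_m ≤ 2ε_{m+1}` ((2.7)–(2.8) [III]) IS A THEOREM ALONG EVERY MONOTONE WINDOWED
# HISTORY — node00-def-P11's (hcomp) at the `L`-keyed witness `θ₁₅ᶜ` from the monotonicity `g_m ≤ g_{m+1}` of the run ALONE (plan g67 WORD-136 (D): «discharged in
# K0a's supplier, displayed ONLY if not derivable at the record» — ANSWER: derivable from monotonicity, NOT from the window)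

Cell `pub-ymgap`, seat `pub-ymgap-node00-def-K0a` (g4), FILE 11c (companion of FILE 11b `Node00/Record13InhabitedOfThm1C`).  node00-def-P11's faithful chain
`bgRowAt_of_thm1ScaledSep` (FILE 5 v1.2) carries the run clause (hcomp) `cR·ε_m ≤ 2·cR·ε_{m+1}` — the (2.7)–(2.8) regime of [III]'s thresholds `ε_j = ε(g_j)`,
`ε(g) = g·A₀·(log g⁻²)^{p₀}` (2.4), along an INCREASING flow.  THE LOCATED ANSWER to plan g67 WORD-136 (D) (numbers, not adjectives): at `p₀ = 1` the profile
`f(g) = g·log g⁻²` is increasing on `]0, e⁻¹]` and decreasing on `[e⁻¹, ½]` (`f(e⁻¹) = 2∕e ≈ 0.736`, `f(½) = log 2 ≈ 0.693`), so (i) the WINDOW ALONE does NOT give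
(hcomp): a windowed history with `g_{m+1} = g_m ∕ 10` has `ε_m > 2ε_{m+1}`; (ii) MONOTONICITY `g_m ≤ g_{m+1}` (both in `]0, ½]`) DOES: `f(g) ≤ 2·f(g')` for
`0 < g ≤ g' ≤ ½` (§1: for `g' ≤ e⁻¹` by `log y ≤ y − 1`; for `g' > e⁻¹` by `g·log g⁻¹ ≤ e⁻¹ ≤ 2e⁻¹·log 2 ≤ 2g'·log g'⁻¹`, i.e. `log 4 ≥ 1`).  Monotonicity of the
history of record in the window is the sign `β ≥ 0` of the β-function of record along the run (asymptotic freedom) — a DISPLAYED input of the DAG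
(the `betaPositive`-type leaves), NOT a theorem of the record; so the run guard of the separation-guarded row is «monotone windowed history» (or (hcomp) itself).
[III] = [Balaban1988Convergent], [I] = [Balaban1987RG1], [15] = [Balaban1985Variational].

WHAT THIS FILE PROVES (theorems only).
* §1 `mul_log_inv_le_two_mul` (`g·log g⁻¹ ≤ 2·g'·log g'⁻¹` for `0 < g ≤ g' ≤ ½`), `epsOfRecord_le_two_mul_of_le` (`ε_m ≤ 2ε_{m+1}` at `p₀ = 1`, `0 ≤ A₀`, for
  `0 < g_m ≤ g_{m+1} ≤ ½`).
* §2 ★ `hcomp_theta13OfThm1C_of_monotone` — node00-def-P11's (hcomp) AT `θ₁₅ᶜ` from the monotonicity of the windowed history alone; ★★★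
  `bgSep_theta13OfThm1C_of_thm1ScaledSep_of_monotone (hε hε' hB ha₀ ha₁) (h15 : VariationalThm1ScaledSep F N B₃ a₀ a₁) (hmono) (hC2) (h3I) (h3MS)` — FILE 11b's
  separation-guarded row P11 at `θ₁₅ᶜ` with the run guard (hcomp) REPLACED by (hmono) «`g_m ≤ g_{m+1}` along every windowed run».

HONEST FRAMING.  Elementary real analysis + a re-statement of FILE 11b's theorem; conditional on the same named fact (R1′), derivative members (R2) and run guards
((hmono) instead of (hcomp), (hC2)); nothing of Bałaban asserted; NOT a discharge; K0‴ NOT closed; counts unmoved (typed 28∕28 · discharged 5∕28); one finite 𝕋⁴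
programme at fixed ε — NOT continuum ∕ OS ∕ mass gap ∕ Clay.  No `sorry`, no `axiom`, no `def`, no `instance`, no `notation`.
-/

noncomputable section

open MeasureTheory
open scoped Matrix.Norms.L2Operator

namespace Literature.MathematicalPhysics.QuantumFieldTheory.Balaban1983to89.Node00

open T4Continuum B14.Eq218Concrete B15DeterminingSets B12RegularSpaces111 B14RegularSpaces234 B14Radii T4AxialGaugeSmallField

/-! ## §1. `g·log g⁻¹ ≤ 2·g'·log g'⁻¹` on `0 < g ≤ g' ≤ ½`, and the thresholds' comparability at `p₀ = 1` -/

section Profile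

/-- `g·log(1∕g) ≤ 1∕e` for `g > 0` (from `log x ≤ x − 1` at `x = 1∕(e·g)`). [folklore] -/
private theorem mul_log_inv_le_inv_exp_one' {g : ℝ} (hg : 0 < g) : g * Real.log g⁻¹ ≤ (Real.exp 1)⁻¹ := by
  have he : 0 < Real.exp 1 := Real.exp_pos 1
  have hx : 0 < (Real.exp 1 * g)⁻¹ := inv_pos.mpr (mul_pos he hg)
  have h1 : Real.log (Real.exp 1 * g)⁻¹ ≤ (Real.exp 1 * g)⁻¹ - 1 := Real.log_le_sub_one_of_pos hx
  have h2 : Real.log (Real.exp 1 * g)⁻¹ = Real.log g⁻¹ - 1 := by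
    rw [mul_inv, Real.log_mul (inv_ne_zero he.ne') (inv_ne_zero hg.ne'), Real.log_inv (Real.exp 1), Real.log_exp]
    ring
  have h3 : Real.log g⁻¹ ≤ (Real.exp 1 * g)⁻¹ := by linarith
  calc g * Real.log g⁻¹ ≤ g * (Real.exp 1 * g)⁻¹ := mul_le_mul_of_nonneg_left h3 hg.le
    _ = (Real.exp 1)⁻¹ := by field_simp

/-- **THE PROFILE COMPARABILITY**: `g·log g⁻¹ ≤ 2·(g'·log g'⁻¹)` for `0 < g ≤ g' ≤ ½` — for `g' ≤ e⁻¹` from `log(g'∕g) ≤ g'∕g − 1` and `1 ≤ log g'⁻¹`; for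
`g' > e⁻¹` from `g·log g⁻¹ ≤ e⁻¹ ≤ 2e⁻¹·log 2 ≤ 2g'·log g'⁻¹` (`log 4 ≥ 1`). [cite: Balaban1988Convergent, (2.4) p.255, (2.7)–(2.8) pp.255–256 (elementary)] -/
theorem mul_log_inv_le_two_mul {g g' : ℝ} (hg : 0 < g) (hgg : g ≤ g') (hg' : g' ≤ 1 / 2) :
    g * Real.log g⁻¹ ≤ 2 * (g' * Real.log g'⁻¹) := by
  have hg'0 : 0 < g' := hg.trans_le hgg
  have h2inv : (2 : ℝ) ≤ g'⁻¹ := by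
    rw [le_inv_comm₀ two_pos hg'0, ← one_div]
    exact hg'
  have hlog2 : Real.log 2 ≤ Real.log g'⁻¹ := Real.log_le_log two_pos h2inv
  have hlog2pos : 0 < Real.log 2 := Real.log_pos one_lt_two
  have hlog' : 0 ≤ Real.log g'⁻¹ := hlog2pos.le.trans hlog2
  by_cases hcase : 1 ≤ Real.log g'⁻¹
  · have h1 : Real.log g⁻¹ = Real.log g'⁻¹ + Real.log (g' / g) := by
      rw [← Real.log_mul (inv_ne_zero hg'0.ne') (div_ne_zero hg'0.ne' hg.ne')]
      congr 1
      field_simp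
    have h2 : Real.log (g' / g) ≤ g' / g - 1 := Real.log_le_sub_one_of_pos (div_pos hg'0 hg)
    have h3 : g * Real.log (g' / g) ≤ g' - g := by
      calc g * Real.log (g' / g) ≤ g * (g' / g - 1) := mul_le_mul_of_nonneg_left h2 hg.le
        _ = g' - g := by field_simp
    have h4 : g * Real.log g'⁻¹ ≤ g' * Real.log g'⁻¹ := mul_le_mul_of_nonneg_right hgg hlog'
    have h5 : g' ≤ g' * Real.log g'⁻¹ := by
      calc g' = g' * 1 := (mul_one _).symm
        _ ≤ g' * Real.log g'⁻¹ := mul_le_mul_of_nonneg_left hcase hg'0.le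
    calc g * Real.log g⁻¹ = g * Real.log g'⁻¹ + g * Real.log (g' / g) := by rw [h1]; ring
      _ ≤ g' * Real.log g'⁻¹ + (g' - g) := add_le_add h4 h3
      _ ≤ g' * Real.log g'⁻¹ + g' * Real.log g'⁻¹ := by linarith
      _ = 2 * (g' * Real.log g'⁻¹) := by ring
  · rw [not_le] at hcase
    have hA : g * Real.log g⁻¹ ≤ (Real.exp 1)⁻¹ := mul_log_inv_le_inv_exp_one' hg
    have hg'e : (Real.exp 1)⁻¹ ≤ g' := by
      have h : g'⁻¹ < Real.exp 1 := by
        have := (Real.log_lt_iff_lt_exp (inv_pos.mpr hg'0)).mp hcase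
        simpa using this
      exact ((inv_lt_comm₀ hg'0 (Real.exp_pos 1)).mp h).le
    have hlog4 : (1 : ℝ) ≤ 2 * Real.log 2 := by
      have := Real.log_two_gt_d9
      linarith
    have he0 : 0 ≤ (Real.exp 1)⁻¹ := (inv_pos.mpr (Real.exp_pos 1)).le
    calc g * Real.log g⁻¹ ≤ (Real.exp 1)⁻¹ := hA
      _ = (Real.exp 1)⁻¹ * 1 := (mul_one _).symm
      _ ≤ (Real.exp 1)⁻¹ * (2 * Real.log 2) := mul_le_mul_of_nonneg_left hlog4 he0
      _ = 2 * ((Real.exp 1)⁻¹ * Real.log 2) := by ring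
      _ ≤ 2 * (g' * Real.log g'⁻¹) := mul_le_mul_of_nonneg_left (mul_le_mul hg'e hlog2 hlog2pos.le hg'0.le) two_pos.le

/-- **THE THRESHOLDS ARE COMPARABLE ALONG AN INCREASING STEP IN THE WINDOW** ((2.7)–(2.8)): at `p₀ = 1`, `0 ≤ A₀`, `0 < g_m ≤ g_{m+1} ≤ ½` give
`ε_m ≤ 2ε_{m+1}` for `ε_m = g_m·A₀·log g_m⁻²`. [cite: Balaban1988Convergent, (2.4) p.255, (2.7)–(2.8) pp.255–256] -/
theorem epsOfRecord_le_two_mul_of_le (ν : Stage7Numerics) (hp : ν.p₀ = 1) (hA : 0 ≤ ν.A₀) {g : ℕ → ℝ} {m : ℕ}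
    (h0 : 0 < g m) (hle : g m ≤ g (m + 1)) (hhalf : g (m + 1) ≤ 1 / 2) :
    epsOfRecord ν g m ≤ 2 * epsOfRecord ν g (m + 1) := by
  have h0' : 0 < g (m + 1) := h0.trans_le hle
  unfold epsOfRecord p0Profile
  rw [hp, pow_one, pow_one]
  have hsq : ∀ x : ℝ, 0 < x → Real.log (x ^ 2)⁻¹ = 2 * Real.log x⁻¹ := by
    intro x _
    rw [← inv_pow, Real.log_pow]
    norm_num
  rw [hsq _ h0, hsq _ h0']
  have key := mul_log_inv_le_two_mul h0 hle hhalf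
  calc g m * (ν.A₀ * (2 * Real.log (g m)⁻¹)) = 2 * ν.A₀ * (g m * Real.log (g m)⁻¹) := by ring
    _ ≤ 2 * ν.A₀ * (2 * (g (m + 1) * Real.log (g (m + 1))⁻¹)) := mul_le_mul_of_nonneg_left key (by positivity)
    _ = 2 * (g (m + 1) * (ν.A₀ * (2 * Real.log (g (m + 1))⁻¹))) := by ring

end Profile

/-! ## §2. (hcomp) AT `θ₁₅ᶜ` FROM THE MONOTONICITY OF THE WINDOWED HISTORY, and the separation-guarded row with that run guard -/

section Monotone

variable {F : T4Family} {N : ℕ} [NeZero N] {ε₀ ε₂₉ B₃ a₀ a₁ : ℝ}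

/-- **★ node00-def-P11's (hcomp) AT `θ₁₅ᶜ` from the MONOTONICITY of the windowed history alone** (`cR = 1`, `p₀ = 1`, `A₀ᶜ ≥ 0`, window `]0, ½]`).  Not derivable from
the window alone (a history falling by a factor `10` inside `]0, ½]` violates it). [cite: Balaban1988Convergent, (2.4) p.255, (2.7)–(2.8) pp.255–256; Balaban1987RG1, Thm 1 p.259] -/
theorem hcomp_theta13OfThm1C_of_monotone (hB : 0 ≤ B₃) (ha₀ : 0 ≤ a₀) (ha₁ : 0 ≤ a₁)
    (hmono : ∀ (p : B12.RunParams) (n : ℕ), n ≤ p.K →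
      Step.InInterval (theta13OfThm1C F N ε₀ ε₂₉ B₃ a₀ a₁).γ n (gOfRecord₁₃ F N (theta13OfThm1C F N ε₀ ε₂₉ B₃ a₀ a₁) p) → ∀ m, m < n →
      gOfRecord₁₃ F N (theta13OfThm1C F N ε₀ ε₂₉ B₃ a₀ a₁) p m ≤ gOfRecord₁₃ F N (theta13OfThm1C F N ε₀ ε₂₉ B₃ a₀ a₁) p (m + 1)) :
    ∀ (p : B12.RunParams) (n : ℕ), n ≤ p.K →
      Step.InInterval (theta13OfThm1C F N ε₀ ε₂₉ B₃ a₀ a₁).γ n (gOfRecord₁₃ F N (theta13OfThm1C F N ε₀ ε₂₉ B₃ a₀ a₁) p) → ∀ m, m < n →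
      (theta13OfThm1C F N ε₀ ε₂₉ B₃ a₀ a₁).s2.cR *
          epsOfRecord (theta13OfThm1C F N ε₀ ε₂₉ B₃ a₀ a₁).ν (gOfRecord₁₃ F N (theta13OfThm1C F N ε₀ ε₂₉ B₃ a₀ a₁) p) m ≤
        2 * ((theta13OfThm1C F N ε₀ ε₂₉ B₃ a₀ a₁).s2.cR *
          epsOfRecord (theta13OfThm1C F N ε₀ ε₂₉ B₃ a₀ a₁).ν (gOfRecord₁₃ F N (theta13OfThm1C F N ε₀ ε₂₉ B₃ a₀ a₁) p) (m + 1)) := by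
  intro p n hn hw m hm
  rw [theta13OfThm1C_cR, one_mul, one_mul]
  have hγ := theta13OfThm1C_γ F N ε₀ ε₂₉ B₃ a₀ a₁
  have h0 : 0 < gOfRecord₁₃ F N (theta13OfThm1C F N ε₀ ε₂₉ B₃ a₀ a₁) p m := (hw m hm.le).1
  have hhalf : gOfRecord₁₃ F N (theta13OfThm1C F N ε₀ ε₂₉ B₃ a₀ a₁) p (m + 1) ≤ 1 / 2 := (hw (m + 1) hm).2.trans hγ.le
  exact epsOfRecord_le_two_mul_of_le _ (theta13OfThm1C_p₀ F N ε₀ ε₂₉ B₃ a₀ a₁)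
    (by rw [theta13OfThm1C_A₀]; exact A0OfThm1C_nonneg hB ha₀ ha₁) h0 (hmono p n hn hw m hm) hhalf

/-- **★★★ THE SEPARATION-GUARDED ROW P11 AT `θ₁₅ᶜ` WITH THE RUN GUARD «MONOTONE WINDOWED HISTORY»** — FILE 11b's `bgSep_theta13OfThm1C_of_thm1ScaledSep` with
node00-def-P11's (hcomp) DISCHARGED by `hcomp_theta13OfThm1C_of_monotone`: from (R1′) `VariationalThm1ScaledSep F N B₃ a₀ a₁`, (R2) `h3I` ∕ `h3MS`, and the two
displayed run guards (hmono) «`g_m ≤ g_{m+1}` along every windowed run» (the sign of the β-function of record along the run — the DAG's displayed input) and (hC2)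
«`L^j·M·R_j ∣ 2L^{m+K}`».  CONDITIONAL; nothing of Bałaban asserted.
[cite: Balaban1985Variational, Thm 1 (8)–(10) p.279; Balaban1985RegularSpaces, (1.3)–(1.8) p.77; Balaban1988Convergent, (2.7)–(2.8) pp.255–256, (2.27)–(2.28) p.259, (2.34)–(2.41) p.261, p.257; Balaban1987RG1, (1.11)–(1.16) p.262] -/
theorem bgSep_theta13OfThm1C_of_thm1ScaledSep_of_monotone (hε : 0 < ε₀) (hε' : 0 < ε₂₉) (hB : 0 ≤ B₃) (ha₀ : 0 < a₀) (ha₁ : 0 < a₁)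
    (h15 : VariationalThm1ScaledSep F N B₃ a₀ a₁)
    (hmono : ∀ (p : B12.RunParams) (n : ℕ), n ≤ p.K →
      Step.InInterval (theta13OfThm1C F N ε₀ ε₂₉ B₃ a₀ a₁).γ n (gOfRecord₁₃ F N (theta13OfThm1C F N ε₀ ε₂₉ B₃ a₀ a₁) p) → ∀ m, m < n →
      gOfRecord₁₃ F N (theta13OfThm1C F N ε₀ ε₂₉ B₃ a₀ a₁) p m ≤ gOfRecord₁₃ F N (theta13OfThm1C F N ε₀ ε₂₉ B₃ a₀ a₁) p (m + 1))
    (hC2 : ∀ (p : B12.RunParams) (n : ℕ), n ≤ p.K → Step.InInterval (theta13OfThm1C F N ε₀ ε₂₉ B₃ a₀ a₁).γ n (gOfRecord₁₃ F N (theta13OfThm1C F N ε₀ ε₂₉ B₃ a₀ a₁) p) → ∀ j, 1 ≤ j → j ≤ n →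
      dCubeSide (F.P p.K).L (theta13OfThm1C F N ε₀ ε₂₉ B₃ a₀ a₁).τ9.M (RkOfRecord (F.P p.K).L (theta13OfThm1C F N ε₀ ε₂₉ B₃ a₀ a₁).ν.r (gOfRecord₁₃ F N (theta13OfThm1C F N ε₀ ε₂₉ B₃ a₀ a₁) p j)) j ∣ (F.P p.K).sitesPerDir 0)
    (h3I : ∀ (p : B12.RunParams) (n : ℕ), n ≤ p.K → Step.InInterval (theta13OfThm1C F N ε₀ ε₂₉ B₃ a₀ a₁).γ n (gOfRecord₁₃ F N (theta13OfThm1C F N ε₀ ε₂₉ B₃ a₀ a₁) p) →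
      ∀ s : SeqOfRecord F (theta13OfThm1C F N ε₀ ε₂₉ B₃ a₀ a₁).ν (theta13OfThm1C F N ε₀ ε₂₉ B₃ a₀ a₁).τ9.M (gOfRecord₁₃ F N (theta13OfThm1C F N ε₀ ε₂₉ B₃ a₀ a₁) p) p.K n, Sect2.SeqSeparated (theta13OfThm1C F N ε₀ ε₂₉ B₃ a₀ a₁).ν.M₁ s → ∀ W : MSField (F.P p.K) (SU N),
      W ∈ suppOfRecord₁₃ F N (theta13OfThm1C F N ε₀ ε₂₉ B₃ a₀ a₁) p n s → W ∈ solvableDom (avOfRecord F N p.K) (regMSOfRecord F N (theta13OfThm1C F N ε₀ ε₂₉ B₃ a₀ a₁).ν p.K n s.Ω) (genSet s.Ω n) →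
      ∀ j, 1 ≤ j → j ≤ n → ∀ X : (Sect2.domSys (F.P p.K) (theta13OfThm1C F N ε₀ ε₂₉ B₃ a₀ a₁).τ9.M j).Dom, Sect2.domSites (F.P p.K) (theta13OfThm1C F N ε₀ ε₂₉ B₃ a₀ a₁).τ9.M j X ⊆ s.Λ j →
      ∀ a ∈ cubeIndices (F.P p.K) (B14.Eq213MaximalDomains.side (F.P p.K).L (theta13OfThm1C F N ε₀ ε₂₉ B₃ a₀ a₁).τ9.M (j + 1)),
        (cubeEnl (F.P p.K) (B14.Eq213MaximalDomains.side (F.P p.K).L (theta13OfThm1C F N ε₀ ε₂₉ B₃ a₀ a₁).τ9.M (j + 1)) a 0 ∩ Sect2.domSites (F.P p.K) (theta13OfThm1C F N ε₀ ε₂₉ B₃ a₀ a₁).τ9.M j X).Nonempty →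
        ∀ q ∈ (Sect2.regionOfSet (F.P p.K) (cubeEnl (F.P p.K) (B14.Eq213MaximalDomains.side (F.P p.K).L (theta13OfThm1C F N ε₀ ε₂₉ B₃ a₀ a₁).τ9.M (j + 1)) a 0 ∩
            Sect2.domSites (F.P p.K) (theta13OfThm1C F N ε₀ ε₂₉ B₃ a₀ a₁).τ9.M j X)).dpairs,
          ‖grad ((F.P p.K).eta j) q.2.1 (fun y => axialPotential (UbgMSOfRecord F N (theta13OfThm1C F N ε₀ ε₂₉ B₃ a₀ a₁).ν (theta13OfThm1C F N ε₀ ε₂₉ B₃ a₀ a₁).τ9.M (gOfRecord₁₃ F N (theta13OfThm1C F N ε₀ ε₂₉ B₃ a₀ a₁) p) p.K n s W)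
            (boxLo (B14.Eq213MaximalDomains.side (F.P p.K).L (theta13OfThm1C F N ε₀ ε₂₉ B₃ a₀ a₁).τ9.M (j + 1)) a) (boxHi (B14.Eq213MaximalDomains.side (F.P p.K).L (theta13OfThm1C F N ε₀ ε₂₉ B₃ a₀ a₁).τ9.M (j + 1)) a) ((F.P p.K).eta j) ⟨y, q.2.2⟩) q.1‖ <
            (theta13OfThm1C F N ε₀ ε₂₉ B₃ a₀ a₁).s2.cB * (lfOfRecord₁₂ F N (theta13OfThm1C F N ε₀ ε₂₉ B₃ a₀ a₁).toStage12Params).alpha0 (gOfRecord₁₃ F N (theta13OfThm1C F N ε₀ ε₂₉ B₃ a₀ a₁) p j))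
    (h3MS : ∀ (p : B12.RunParams) (n : ℕ), n ≤ p.K → Step.InInterval (theta13OfThm1C F N ε₀ ε₂₉ B₃ a₀ a₁).γ n (gOfRecord₁₃ F N (theta13OfThm1C F N ε₀ ε₂₉ B₃ a₀ a₁) p) →
      ∀ s : SeqOfRecord F (theta13OfThm1C F N ε₀ ε₂₉ B₃ a₀ a₁).ν (theta13OfThm1C F N ε₀ ε₂₉ B₃ a₀ a₁).τ9.M (gOfRecord₁₃ F N (theta13OfThm1C F N ε₀ ε₂₉ B₃ a₀ a₁) p) p.K n, Sect2.SeqSeparated (theta13OfThm1C F N ε₀ ε₂₉ B₃ a₀ a₁).ν.M₁ s → ∀ W : MSField (F.P p.K) (SU N),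
      W ∈ suppOfRecord₁₃ F N (theta13OfThm1C F N ε₀ ε₂₉ B₃ a₀ a₁) p n s → W ∈ solvableDom (avOfRecord F N p.K) (regMSOfRecord F N (theta13OfThm1C F N ε₀ ε₂₉ B₃ a₀ a₁).ν p.K n s.Ω) (genSet s.Ω n) →
      ∀ j, 1 ≤ j → j ≤ n → ∀ X : (Sect2.domSys (F.P p.K) (theta13OfThm1C F N ε₀ ε₂₉ B₃ a₀ a₁).τ9.M j).Dom, ∀ m, 1 ≤ m → m ≤ j →
      ∀ a ∈ cubeIndices (F.P p.K) (B14.Eq213MaximalDomains.side (F.P p.K).L (theta13OfThm1C F N ε₀ ε₂₉ B₃ a₀ a₁).τ9.M m),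
        (cubeEnl (F.P p.K) (B14.Eq213MaximalDomains.side (F.P p.K).L (theta13OfThm1C F N ε₀ ε₂₉ B₃ a₀ a₁).τ9.M m) a 0 ∩ Sect2.domSites (F.P p.K) (theta13OfThm1C F N ε₀ ε₂₉ B₃ a₀ a₁).τ9.M j X).Nonempty →
        cubeEnl (F.P p.K) (B14.Eq213MaximalDomains.side (F.P p.K).L (theta13OfThm1C F N ε₀ ε₂₉ B₃ a₀ a₁).τ9.M m) a 0 ⊆ s.Ω m →
        ∀ q ∈ (Sect2.regionOfSet (F.P p.K) (cubeEnl (F.P p.K) (B14.Eq213MaximalDomains.side (F.P p.K).L (theta13OfThm1C F N ε₀ ε₂₉ B₃ a₀ a₁).τ9.M m) a 0 ∩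
            Sect2.domSites (F.P p.K) (theta13OfThm1C F N ε₀ ε₂₉ B₃ a₀ a₁).τ9.M j X)).dpairs,
          (((F.P p.K).L : ℝ) ^ m * (F.P p.K).eta j) ^ 2 *
            ‖grad ((F.P p.K).eta j) q.2.1 (fun y => axialPotential (UbgMSOfRecord F N (theta13OfThm1C F N ε₀ ε₂₉ B₃ a₀ a₁).ν (theta13OfThm1C F N ε₀ ε₂₉ B₃ a₀ a₁).τ9.M (gOfRecord₁₃ F N (theta13OfThm1C F N ε₀ ε₂₉ B₃ a₀ a₁) p) p.K n s W)
              (boxLo (B14.Eq213MaximalDomains.side (F.P p.K).L (theta13OfThm1C F N ε₀ ε₂₉ B₃ a₀ a₁).τ9.M m) a) (boxHi (B14.Eq213MaximalDomains.side (F.P p.K).L (theta13OfThm1C F N ε₀ ε₂₉ B₃ a₀ a₁).τ9.M m) a) ((F.P p.K).eta j) ⟨y, q.2.2⟩) q.1‖ <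
            rad238 (theta13OfThm1C F N ε₀ ε₂₉ B₃ a₀ a₁).s2.B (theta13OfThm1C F N ε₀ ε₂₉ B₃ a₀ a₁).s2.C (theta13OfThm1C F N ε₀ ε₂₉ B₃ a₀ a₁).s2.Mr ((lfOfRecord₁₂ F N (theta13OfThm1C F N ε₀ ε₂₉ B₃ a₀ a₁).toStage12Params).alpha0 (gOfRecord₁₃ F N (theta13OfThm1C F N ε₀ ε₂₉ B₃ a₀ a₁) p m))) :
    ∀ (p : B12.RunParams) (n : ℕ), n ≤ p.K → Step.InInterval (theta13OfThm1C F N ε₀ ε₂₉ B₃ a₀ a₁).γ n (gOfRecord₁₃ F N (theta13OfThm1C F N ε₀ ε₂₉ B₃ a₀ a₁) p) →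
      ∀ s : SeqOfRecord F (theta13OfThm1C F N ε₀ ε₂₉ B₃ a₀ a₁).ν (theta13OfThm1C F N ε₀ ε₂₉ B₃ a₀ a₁).τ9.M (gOfRecord₁₃ F N (theta13OfThm1C F N ε₀ ε₂₉ B₃ a₀ a₁) p) p.K n, Sect2.SeqSeparated (theta13OfThm1C F N ε₀ ε₂₉ B₃ a₀ a₁).ν.M₁ s →
      ∀ W : MSField (F.P p.K) (SU N), W ∈ suppOfRecord₁₃ F N (theta13OfThm1C F N ε₀ ε₂₉ B₃ a₀ a₁) p n s →
      ∀ j, 1 ≤ j → j ≤ n → ∀ X : (Sect2.domSys (F.P p.K) (theta13OfThm1C F N ε₀ ε₂₉ B₃ a₀ a₁).τ9.M j).Dom,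
      (Sect2.domSites (F.P p.K) (theta13OfThm1C F N ε₀ ε₂₉ B₃ a₀ a₁).τ9.M j X ⊆ s.Λ j →
        Sect2.ofBackgroundC (settingOfRecord₁₃ F N (theta13OfThm1C F N ε₀ ε₂₉ B₃ a₀ a₁) p).ι (UbgOfRecord₁₃ F N (theta13OfThm1C F N ε₀ ε₂₉ B₃ a₀ a₁) p n s W) ∈
          Sect2.spaceI (settingOfRecord₁₃ F N (theta13OfThm1C F N ε₀ ε₂₉ B₃ a₀ a₁) p) ((theta13OfThm1C F N ε₀ ε₂₉ B₃ a₀ a₁).Rz p.K) (theta13OfThm1C F N ε₀ ε₂₉ B₃ a₀ a₁).τ9.M j (Sect2.domSites (F.P p.K) (theta13OfThm1C F N ε₀ ε₂₉ B₃ a₀ a₁).τ9.M j X)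
            ((settingOfRecord₁₃ F N (theta13OfThm1C F N ε₀ ε₂₉ B₃ a₀ a₁) p).lf.alpha0 ((settingOfRecord₁₃ F N (theta13OfThm1C F N ε₀ ε₂₉ B₃ a₀ a₁) p).flow.g j)) ((settingOfRecord₁₃ F N (theta13OfThm1C F N ε₀ ε₂₉ B₃ a₀ a₁) p).lf.alpha1 ((settingOfRecord₁₃ F N (theta13OfThm1C F N ε₀ ε₂₉ B₃ a₀ a₁) p).flow.g j))) ∧
      (Sect2.admB (F.P p.K) (theta13OfThm1C F N ε₀ ε₂₉ B₃ a₀ a₁).ν (theta13OfThm1C F N ε₀ ε₂₉ B₃ a₀ a₁).τ9.M (gOfRecord₁₃ F N (theta13OfThm1C F N ε₀ ε₂₉ B₃ a₀ a₁) p) s.Ω s.Λ j (Sect2.domSites (F.P p.K) (theta13OfThm1C F N ε₀ ε₂₉ B₃ a₀ a₁).τ9.M j X) = true →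
        Sect2.ofBackgroundC (settingOfRecord₁₃ F N (theta13OfThm1C F N ε₀ ε₂₉ B₃ a₀ a₁) p).ι (UbgOfRecord₁₃ F N (theta13OfThm1C F N ε₀ ε₂₉ B₃ a₀ a₁) p n s W) ∈
          Sect2.spaceMS (settingOfRecord₁₃ F N (theta13OfThm1C F N ε₀ ε₂₉ B₃ a₀ a₁) p) ((theta13OfThm1C F N ε₀ ε₂₉ B₃ a₀ a₁).Rz p.K) (theta13OfThm1C F N ε₀ ε₂₉ B₃ a₀ a₁).τ9.M j (Sect2.domSites (F.P p.K) (theta13OfThm1C F N ε₀ ε₂₉ B₃ a₀ a₁).τ9.M j X) s.Ω) :=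
  bgSep_theta13OfThm1C_of_thm1ScaledSep hε hε' hB ha₀ ha₁ h15 (hcomp_theta13OfThm1C_of_monotone hB ha₀.le ha₁.le hmono) hC2 h3I h3MS

end Monotone

end Literature.MathematicalPhysics.QuantumFieldTheory.Balaban1983to89.Node00

end
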